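import Literature.Computability.AlgebraicComplexity.CircuitDepth
import Literature.Computability.AlgebraicComplexity.DepthReductionProofs
import HarnessLib

/-!
# `ΣΠ` circuits: every polynomial has product-depth `≤ 1` (discharges for `CircuitDepth.lean`)

(Sibling proof file of `CircuitDepth.lean`, named after the fact it discharges; it cannot be
appended to `CircuitDepth.lean` itself because it reuses `DepthReductionProofs.lean`, which
imports `CircuitDepth.lean`.)

Discharge (D-0014) of two named facts of
`Literature/Computability/AlgebraicComplexity/CircuitDepth.lean`:

* `ArithCircuit.exists_computes_productDepth_one` (Limaye–Srinivasan–Tavenas 2021, §1): every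
  `f : MvPolynomial σ k` is computed by a well-formed unbounded-fan-in circuit of product-depth
  `≤ 1` — proved here as `ArithCircuit.exists_computes_productDepth_one_holds`;
* `productDepthCircuitSize_ne_top`: hence `productDepthCircuitSize Δ f < ⊤` for `1 ≤ Δ` —
  `productDepthCircuitSize_ne_top_holds`, together with the quantitative form
  `productDepthCircuitSize_one_le`: `productDepthCircuitSize 1 f ≤ #supp f + 1`.

## Source and proof

LST 2021, §1 ("Background on Algebraic Circuits"; J. ACM version p. 26:2): the *product-depth*
of a circuit is the maximum number of product gates on a root-to-leaf path, and the circuits of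
product-depth `1` are the `ΣΠΣ` formulas, "linear combinations of products of linear
combinations of the input variables". That every polynomial has such a circuit is the remark
(used in LST 2021 at the base of the homogenisation induction, case `ΣΠ`: the outputs "are
computed as linear combinations of monomials") that `f = ∑_{m ∈ supp f} coeff_m(f) · X^m`
(`MvPolynomial.support_sum_monomial_coeff`) with each `X^m` a single product of variables.

The witness `ArithCircuit.sumOfMonomials ms f` is exactly this `ΣΠ` circuit in the tree's
list-based model, along an enumeration `ms` of the support: the layer
`DepthReduction.layerM ms` of product gates `monomialGate m = ∏ (variables of m, with
multiplicity)` followed by the single weighted sum gate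
`DepthReduction.pieceGate ms f = ∑_μ coeff_{ms[μ]}(f) · gate μ`, which is the output. Both
layers and their semantics (`gateValues_layerM`, `eval_pieceGate`) and the depth bookkeeping
(`gateWDepths_layer`, `foldr_max_le`, `depthIn_le`) are REUSED from
`DepthReductionProofs.lean`, where they form the two bottom layers of Tavenas' `ΣΠΣΠ`
builder `DepthReduction.sigmaPiCircuit`; nothing is re-declared. The circuit has
`#ms + 1` gates, is well formed (product gates refer to no gate, the sum gate to the product
gates only), computes `f` as soon as `ms` enumerates a superset of the support without
repetition, and has product-depth `≤ 1` (every product gate has weighted depth `1`, the sum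
gate adds `0`). No finiteness or decidability assumption on `σ` is needed (the enumeration
`f.support.toList` is noncomputable anyway).

## References

* N. Limaye, S. Srinivasan, S. Tavenas, *Superpolynomial lower bounds against low-depth
  algebraic circuits*, FOCS 2021, 804–814 (J. ACM 72 (2025), Art. 26), §1.
* S. Tavenas, *Improved bounds for reduction to depth 4 and depth 3*, Inform. and Comput. 240
  (2015), §6 (the `ΣΠΣΠ` builder whose bottom layers are reused).
-/

noncomputable section

open MvPolynomial

namespace Literature.Computability.AlgebraicComplexity

universe u v

namespace ArithCircuit

variable {k : Type u} {σ : Type v} [CommSemiring k]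

open DepthReduction

/-- The `ΣΠ` circuit of `f` along a list `ms` of monomials (meant to enumerate the support of
`f`): one product gate `monomialGate m` (the variables of `m`, with multiplicity) per `m ∈ ms`,
followed by the weighted sum gate `∑_μ coeff_{ms[μ]}(f) • gate μ`, which is the output — a
"linear combination of monomials", i.e. a circuit of product-depth `≤ 1`
(Limaye–Srinivasan–Tavenas 2021, §1). [cite: LST2021, §1] -/
def sumOfMonomials (ms : List (σ →₀ ℕ)) (f : MvPolynomial σ k) : ArithCircuit k σ where
  gates := layerM ms ++ [pieceGate ms f]
  output := .gate ms.length

/-- The `ΣΠ` circuit along `ms` has `#ms + 1` gates (LST 2021, §1: size = number of gates). [cite: LST2021, §1] -/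
@[simp]
theorem size_sumOfMonomials (ms : List (σ →₀ ℕ)) (f : MvPolynomial σ k) :
    (sumOfMonomials ms f).size = ms.length + 1 := by
  simp [sumOfMonomials, ArithCircuit.size, length_layerM]

/-- The `ΣΠ` circuit is well formed: the product gates refer to no gate, the sum gate (number
`#ms`) refers to the product gates `0, …, #ms - 1` only, and the output is the sum gate
(Bürgisser 2000, Def. 2.1; LST 2021, §1). [cite: LST2021, §1] -/
theorem wellFormed_sumOfMonomials (ms : List (σ →₀ ℕ)) (f : MvPolynomial σ k) :
    (sumOfMonomials ms f).WellFormed := by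
  refine ⟨fun i g hg u hu => ?_, ?_⟩
  · change (layerM ms ++ [pieceGate ms f])[i]? = some g at hg
    by_cases hi : i < ms.length
    · rw [List.getElem?_append_left (by rwa [length_layerM])] at hg
      obtain ⟨m, -, rfl⟩ := List.mem_map.1 (List.mem_of_getElem? hg)
      obtain ⟨j, rfl⟩ := args_monomialGate m u hu
      trivial
    · rw [List.getElem?_append_right (by rw [length_layerM]; omega), length_layerM,
        List.getElem?_singleton] at hg
      split_ifs at hg with h0
      obtain rfl := Option.some.inj hg
      simp only [pieceGate, Gate.args, List.map_map, List.mem_map] at hu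
      obtain ⟨μ, -, rfl⟩ := hu
      change μ.val < i
      omega
  · change ms.length < (layerM ms ++ [pieceGate ms f]).length
    simp [length_layerM]

/-- The `ΣΠ` circuit along an enumeration `ms` (without repetition) of a superset of the support
of `f` computes `f = ∑_{m ∈ supp f} coeff_m(f) X^m` (LST 2021, §1: "linear combinations of
monomials"). [cite: LST2021, §1] -/
theorem eval_sumOfMonomials {ms : List (σ →₀ ℕ)} (hnd : ms.Nodup) {f : MvPolynomial σ k}
    (hf : ∀ m ∈ f.support, m ∈ ms) : (sumOfMonomials ms f).eval = f := by
  classical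
  have hvals : gateValues (sumOfMonomials ms f).gates =
      (ms.map fun m => monomial m (1 : k)) ++ [f] := by
    change gateValues (layerM ms ++ [pieceGate ms f]) = _
    rw [gateValues_append_singleton, gateValues_layerM,
      eval_pieceGate ms hnd fun m hm => List.mem_toFinset.mpr (hf m hm)]
  change (Operand.gate ms.length : Operand k σ).eval (gateValues (sumOfMonomials ms f).gates) = f
  rw [hvals, Operand.eval_gate, List.getD_eq_getElem?_getD,
    List.getElem?_append_right (by simp), List.length_map, Nat.sub_self]
  simp

/-- Hence the `ΣΠ` circuit along such an enumeration computes `f` (LST 2021, §1). [cite: LST2021, §1] -/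
theorem computes_sumOfMonomials {ms : List (σ →₀ ℕ)} (hnd : ms.Nodup) {f : MvPolynomial σ k}
    (hf : ∀ m ∈ f.support, m ∈ ms) : (sumOfMonomials ms f).Computes f :=
  eval_sumOfMonomials hnd hf

/-- The `ΣΠ` circuit has product-depth `≤ 1`: every product gate has product-depth `1` (its
operands are variables), and the sum gate on top adds nothing (LST 2021, §1: a `ΣΠ ⊆ ΣΠΣ`
circuit has `Δ = 1`). [cite: LST2021, §1] -/
theorem productDepth_sumOfMonomials_le (ms : List (σ →₀ ℕ)) (f : MvPolynomial σ k) :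
    (sumOfMonomials ms f).productDepth ≤ 1 := by
  unfold ArithCircuit.productDepth ArithCircuit.wdepth
  generalize hw : (fun g : Gate k σ => if g.isProd then 1 else 0) = w
  have hw_prod : ∀ args, w (.prod args) = 1 := fun _ => by rw [← hw]; rfl
  have hw_sum : ∀ args, w (.sum args) = 0 := fun _ => by rw [← hw]; rfl
  have h1 : ∀ x ∈ gateWDepths w (layerM ms : List (Gate k σ)), x ≤ 1 := by
    have := gateWDepths_layer w [] (layerM ms) (refs_layerM ms)
    simp only [List.nil_append] at this
    rw [this]
    intro x hx
    simp only [gateWDepths, List.foldl_nil, List.nil_append, List.mem_map] at hx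
    obtain ⟨g, hg, rfl⟩ := hx
    simp only [layerM, List.mem_map] at hg
    obtain ⟨m, -, rfl⟩ := hg
    have h0 : ((monomialGate m : Gate k σ).args.map
        (Operand.depthIn ([] : List ℕ))).foldr max 0 ≤ 0 :=
      foldr_max_le fun x hx => by
        obtain ⟨u, hu, rfl⟩ := List.mem_map.1 hx
        obtain ⟨j, rfl⟩ := args_monomialGate m u hu
        exact le_rfl
    have hwm : w (monomialGate m : Gate k σ) = 1 := hw_prod _
    omega
  have h2 : ∀ x ∈ gateWDepths w (sumOfMonomials ms f).gates, x ≤ 1 := by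
    change ∀ x ∈ gateWDepths w (layerM ms ++ [pieceGate ms f]), x ≤ 1
    rw [gateWDepths_append_singleton]
    intro x hx
    rcases List.mem_append.1 hx with hx | hx
    · exact h1 x hx
    · simp only [List.mem_singleton] at hx
      subst hx
      rw [pieceGate, hw_sum, zero_add]
      exact foldr_max_le fun x hx => by
        obtain ⟨u, -, rfl⟩ := List.mem_map.1 hx
        exact depthIn_le h1 u
  exact depthIn_le h2 _

/-- **Discharge** of the named fact `ArithCircuit.exists_computes_productDepth_one`
(`CircuitDepth.lean`): every polynomial is computed by a well-formed `ΣΠ` circuit of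
product-depth `≤ 1` — one product gate per monomial of its support and one weighted sum gate on
top (Limaye–Srinivasan–Tavenas 2021, §1); no finiteness of the variable type is needed. [cite: LST2021, §1] -/
theorem exists_computes_productDepth_one_holds :
    exists_computes_productDepth_one (k := k) (σ := σ) := fun f =>
  ⟨sumOfMonomials f.support.toList f, wellFormed_sumOfMonomials _ _,
    computes_sumOfMonomials (Finset.nodup_toList _) (fun _ hm => Finset.mem_toList.mpr hm),
    productDepth_sumOfMonomials_le _ _⟩

end ArithCircuit

section MeasureLemmas

variable {k : Type u} {σ : Type v} [CommSemiring k]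

/-- Quantitative form: `productDepthCircuitSize 1 f ≤ #supp f + 1`, witnessed by the `ΣΠ`
circuit of `f` along its support (LST 2021, §1). [cite: LST2021, §1] -/
theorem productDepthCircuitSize_one_le (f : MvPolynomial σ k) :
    productDepthCircuitSize 1 f ≤ ((f.support.card + 1 : ℕ) : ℕ∞) := by
  have h := productDepthCircuitSize_le
    (ArithCircuit.computes_sumOfMonomials (Finset.nodup_toList f.support)
      (fun _ hm => Finset.mem_toList.mpr hm))
    (ArithCircuit.productDepth_sumOfMonomials_le f.support.toList f)
  rwa [ArithCircuit.size_sumOfMonomials, Finset.length_toList] at h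

/-- **Discharge** of the named fact `productDepthCircuitSize_ne_top` (`CircuitDepth.lean`): for
`1 ≤ Δ` every polynomial has a circuit of product-depth `≤ Δ` (the `ΣΠ` circuit,
`ArithCircuit.exists_computes_productDepth_one_holds`), so `productDepthCircuitSize Δ f ≠ ⊤`
(LST 2021, §1). [cite: LST2021, §1] -/
theorem productDepthCircuitSize_ne_top_holds :
    productDepthCircuitSize_ne_top (k := k) (σ := σ) := by
  intro Δ hΔ f
  obtain ⟨P, -, hf, hP⟩ := ArithCircuit.exists_computes_productDepth_one_holds (k := k) (σ := σ) f
  exact ne_top_of_le_ne_top (ENat.coe_ne_top P.size)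
    (productDepthCircuitSize_le hf (hP.trans hΔ))

end MeasureLemmas

end Literature.Computability.AlgebraicComplexity
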